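import Summits.QuantumFields.BalabanUV.T4Continuum.Support.ActivityTermModel
import Literature.MathematicalPhysics.QuantumFieldTheory.Balaban1983to89.T4OperatorRateLiaison

/-!
# NE5 / U3 — the STEP JUNCTION of the two kernel routes: P2's activity model READING P1's step model

Cell `pub-balaban`, unit `b2b-balaban-t4-ne5-p2-g16` (T⁴ fan-out NE5 ∕ node U3, PROVER seat P2 «polymer-activity Lipschitz
route»); Summits-side new work under the LEAN PLACEMENT RULE (cell mathematics, NOT a Literature module; rung (B)+1 finite
T⁴ — NOT infinite volume, NOT mass gap, NOT Clay, NOT a proof of NE5; `BetaPertH`, (B), (B^μ) are not consumed).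

WHAT IT IS.  The cell's spine estimate NE5 (η-rate of the one-step outputs as functionals of V; NOT PRINTED in
[Balaban1984PropagatorsI]–[Balaban1989LargeFieldII], which print ε-UNIFORM bounds, never η-RATES) is kernel-landed
CONDITIONALLY on two routes with letter-for-letter PARALLEL wall shapes: P1's Cauchy route over
`T4InputCauchyRateData.StepModel` (walls indexed by the STEP `k`, margins `rOp k` ∕ `rHist k`) and P2's activity route over
`T4ActivityRecursion.InputModel` ∕ the explicit term model `ActivityTermModel.TermFamily.model` (walls indexed by the output
DOMAIN `X`, margins `ϱOp X` ∕ `ϱHist X`, exponent `scale X`).  This leaf types the junction: an activity model READS a step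
model (`ReadsStep M N`: the two runs' operator inputs, the two insertion maps and the two margins at `X` are the step model's
at `k = scale X` — six field identities, no mathematics) and then EVERY P1 wall implies the P2 wall of the same name:
`OperatorRate` (W1 = NE2 ∧ NE3), `InsertionRate` (W4), `InsScaleBound` ∕ `InsScaleBoundLevel` (W3), `InsertionDamped(Nat)`
(MI-3a summed form), and the printed-STRUCTURE binders `InsAffine` ∕ `InsBlind` ∕ `InsHomog`; `InBase` transfers when the
admissible classes are read from the step model too.  CONSEQUENCE (`TermFamily.ne5_at_max_of_model_reach_step` ∕ `…above…`):
the term-model closure of part 3 re-emitted with the walls in P1's CURRENCY — `N.OperatorRate W δ θ`,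
`N.InsertionRate W κ E₀ δ′ θ`, `N.InsScaleBound W κ E₁ c ω`, `N.InsAffine W`, `N.InsBlind W`, `N.InsHomog W` — so that ONE
binder set in the row owner's wall names W1 ∕ W3 ∕ W4 (BINDER-OWNERS row NE5; the liaison `T4OperatorRateLiaison` concludes
exactly `StepModel.OperatorRate`, cf. `operatorRate_of_absRate_floor_step`) feeds BOTH kernel routes.  The converse
direction (P2 wall ⇒ P1 wall) is NOT claimed and false in general (a step `k` carrying no output domain is unconstrained by
the `X`-indexed shapes): P2's walls are the WEAKER binders.

STATUS OF EVERY HYPOTHESIS (unchanged from part 3 `ActivityTermModel` and from P1 `T4InputCauchyRateData` v5; nothing is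
discharged here except the six wall TRANSFERS, which are bookkeeping): NOT PRINTED — `ClusterRep.Represents` ∕
`InputModel.Realizes` (MI-R, two-run identification), `StepModel.OperatorRate` (= NE2 ∧ NE3, nodes U1a∕U1b),
`StepModel.InsertionRate`, `StepModel.InsScaleBound` (MI-3a residual G-ne5p1-3a″), the numeric census (R1)–(R3) +
off-resonance; PRINTED KIND for one run — `InBase`, `KPInflated`, `DecayExtract`, `PinBudget`, `DecayBound` ×2,
`InsAffine` ∕ `InsBlind` ∕ `InsHomog` (B13 (1.33) p. 9, (1.41) p. 11), well-formedness and majorant domination of the term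
family.  ABSOLUTE RULE respected: no cell-minted statement is cited as a fact; [Balaban1988RG2Cluster] is cited by the
imported modules for LETTERS and one-run KIND only.  No `sorry`, no new axioms.  Record `t4/T4-EST-U3-NE5-P2.md` §0(w).
-/

open scoped BigOperators

namespace Summit.QuantumFields.BalabanUV.T4Continuum.ActivityStepJunction

open Literature.MathematicalPhysics.QuantumFieldTheory.Balaban1983to89.T4OutputRate (Carriers Functional DecayBound NE5)
open Literature.MathematicalPhysics.QuantumFieldTheory.Balaban1983to89.T4ActivityLipschitz (ClusterRep)
open Literature.MathematicalPhysics.QuantumFieldTheory.Balaban1983to89.T4ActivityRecursion (InputModel KPInflated)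
open Literature.MathematicalPhysics.QuantumFieldTheory.Balaban1983to89.T4InputCauchyRateData (StepModel tableA tableB)
open Literature.MathematicalPhysics.QuantumFieldTheory.Balaban1983to89.T4OperatorRateLiaison
  (AbsOperatorRate operatorRate_of_absRate_floor)
open Summit.QuantumFields.BalabanUV.T4Continuum.ActivityTermModel (TermFamily)

variable {C : Carriers} {R : ClusterRep C} {Op Hist : Type*} [NormedAddCommGroup Op] [NormedSpace ℂ Op]
  [NormedAddCommGroup Hist] [NormedSpace ℂ Hist]

/-! ## §1 An activity model READS a step model: six field identities -/

/-- [folklore] The activity model `M` READS the step model `N`: at every output domain `X` the two runs' operator inputs, the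
two history insertions and the two margins of `M` are those of `N` at the step `k = scale X` (B13 (2.13) p. 14: the step-`k`
cluster functional is a function of the step's operators and of the inserted earlier actions — ONE datum per step, read by
every domain of that scale).  Pure bookkeeping; `Ψ` and `Base` are unconstrained. -/
structure ReadsStep (M : InputModel R Op Hist) (N : StepModel C Op Hist) : Prop where
  opA_eq : ∀ (g : ℕ → ℝ) (U : C.BgB) (X : C.Dom), M.opA g U X = N.opA g U (C.scale X)
  opB_eq : ∀ (g : ℕ → ℝ) (U : C.BgB) (X : C.Dom), M.opB g U X = N.opB g U (C.scale X)
  insA_eq : ∀ (g : ℕ → ℝ) (U : C.BgB) (X : C.Dom) (t : C.Dom → ℝ), M.insA g U X t = N.insA g U (C.scale X) t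
  insB_eq : ∀ (g : ℕ → ℝ) (U : C.BgB) (X : C.Dom) (t : C.Dom → ℝ), M.insB g U X t = N.insB g U (C.scale X) t
  ϱOp_eq : ∀ X : C.Dom, M.ϱOp X = N.rOp (C.scale X)
  ϱHist_eq : ∀ X : C.Dom, M.ϱHist X = N.rHist (C.scale X)

/-- [folklore] The canonical activity model reading a step model, with arbitrary activities `Ψ` and admissible classes. -/
def InputModel.ofStep (N : StepModel C Op Hist) (Ψ : (ℕ → ℝ) → C.BgB → C.Dom → R.P → Op × Hist → ℂ)
    (Base : (ℕ → ℝ) → C.BgB → C.Dom → Set (Op × Hist)) : InputModel R Op Hist where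
  Ψ := Ψ
  opA g U X := N.opA g U (C.scale X)
  opB g U X := N.opB g U (C.scale X)
  insA g U X := N.insA g U (C.scale X)
  insB g U X := N.insB g U (C.scale X)
  Base := Base
  ϱOp X := N.rOp (C.scale X)
  ϱHist X := N.rHist (C.scale X)
  ϱOp_pos _ := N.rOp_pos _
  ϱHist_pos _ := N.rHist_pos _

/-- [folklore] The canonical reading model reads. -/
theorem readsStep_ofStep (N : StepModel C Op Hist) (Ψ : (ℕ → ℝ) → C.BgB → C.Dom → R.P → Op × Hist → ℂ)
    (Base : (ℕ → ℝ) → C.BgB → C.Dom → Set (Op × Hist)) : ReadsStep (InputModel.ofStep (R := R) N Ψ Base) N :=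
  ⟨fun _ _ _ => rfl, fun _ _ _ => rfl, fun _ _ _ _ => rfl, fun _ _ _ _ => rfl, fun _ => rfl, fun _ => rfl⟩

namespace ReadsStep

variable {M : InputModel R Op Hist} {N : StepModel C Op Hist} (h : ReadsStep M N)
include h

/-- [folklore] The two runs' input POINTS of a reading model are the step model's data points at `k = scale X`. -/
theorem pointA_eq (EA : Functional C C.BgA) (g : ℕ → ℝ) (U : C.BgB) (X : C.Dom) :
    M.pointA EA g U X = N.dataA EA g U (C.scale X) := by
  simp only [InputModel.pointA, StepModel.dataA, h.opA_eq, h.insA_eq]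

/-- [folklore] (run B) -/
theorem pointB_eq (EB : Functional C C.BgB) (g : ℕ → ℝ) (U : C.BgB) (X : C.Dom) :
    M.pointB EB g U X = N.dataB EB g U (C.scale X) := by
  simp only [InputModel.pointB, StepModel.dataB, h.opB_eq, h.insB_eq]

/-- [folklore] **W1 transfers**: the step model's `OperatorRate δ θ` (= NE2 ∧ NE3 in operator-margin units, the
conclusion of `T4OperatorRateLiaison`) IS the activity model's `OperatorRate δ θ`. -/
theorem operatorRate {W : Set (ℕ → ℝ)} {δ θ : ℝ} (hN : N.OperatorRate W δ θ) : M.OperatorRate W δ θ := by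
  intro g hg U X
  rw [h.opA_eq, h.opB_eq, h.ϱOp_eq]
  exact hN (C.scale X) g hg U

/-- [folklore] **W4 transfers**: `InsertionRate κ E₀ δ′ θ`. -/
theorem insertionRate {W : Set (ℕ → ℝ)} {κ E₀ δ' θ : ℝ} (hN : N.InsertionRate W κ E₀ δ' θ) :
    M.InsertionRate W κ E₀ δ' θ := by
  intro g hg U X t ht
  rw [h.insA_eq, h.insB_eq, h.ϱHist_eq]
  exact hN (C.scale X) g hg U t ht

/-- [folklore] **W3 transfers**: the single-scale one-run size bound at the reference level, `InsScaleBound κ E₁ c ω`. -/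
theorem insScaleBound {W : Set (ℕ → ℝ)} {κ E₁ c ω : ℝ} (hN : N.InsScaleBound W κ E₁ c ω) :
    M.InsScaleBound W κ E₁ c ω := by
  intro g hg U X t j hj hsupp hbd
  rw [h.insA_eq, h.insA_eq, h.ϱHist_eq]
  exact hN (C.scale X) g hg U t j hj hsupp hbd

/-- [folklore] (W3 with an arbitrary level) `InsScaleBoundLevel κ c ω`. -/
theorem insScaleBoundLevel {W : Set (ℕ → ℝ)} {κ c ω : ℝ} (hN : N.InsScaleBoundLevel W κ c ω) :
    M.InsScaleBoundLevel W κ c ω := by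
  intro g hg U X t j T hj hT hsupp hbd
  rw [h.insA_eq, h.insA_eq, h.ϱHist_eq]
  exact hN (C.scale X) g hg U t j T hj hT hsupp hbd

/-- [folklore] (MI-3a, summed form) `InsertionDamped κ c ω`. -/
theorem insertionDamped {W : Set (ℕ → ℝ)} {κ c ω : ℝ} (hN : N.InsertionDamped W κ c ω) :
    M.InsertionDamped W κ c ω := by
  intro g hg U X t t' D hD hdisc
  rw [h.insA_eq, h.insA_eq, h.ϱHist_eq]
  exact hN (C.scale X) g hg U t t' D hD hdisc

/-- [folklore] (MI-3a, summed form, printed age normalisation) `InsertionDampedNat κ c ω`. -/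
theorem insertionDampedNat {W : Set (ℕ → ℝ)} {κ c ω : ℝ} (hN : N.InsertionDampedNat W κ c ω) :
    M.InsertionDampedNat W κ c ω := by
  intro g hg U X t t' D hD hdisc
  rw [h.insA_eq, h.insA_eq, h.ϱHist_eq]
  exact hN (C.scale X) g hg U t t' D hD hdisc

/-- [folklore] (printed STRUCTURE, B13 (1.33)) `InsAffine`. -/
theorem insAffine {W : Set (ℕ → ℝ)} (hN : N.InsAffine W) : M.InsAffine W := by
  intro g hg U X t t'
  simp only [h.insA_eq]
  exact hN (C.scale X) g hg U t t'

/-- [folklore] (printed STRUCTURE, causality of the recursion) `InsBlind`. -/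
theorem insBlind {W : Set (ℕ → ℝ)} (hN : N.InsBlind W) : M.InsBlind W := by
  intro g hg U X t t' htt'
  rw [h.insA_eq, h.insA_eq]
  exact hN (C.scale X) g hg U t t' htt'

/-- [folklore] (printed STRUCTURE, real homogeneity of the table-driven part) `InsHomog`. -/
theorem insHomog {W : Set (ℕ → ℝ)} (hN : N.InsHomog W) : M.InsHomog W := by
  intro g hg U X a t
  simp only [h.insA_eq]
  exact hN (C.scale X) g hg U a t

/-- [folklore] `InBase` transfers when the admissible classes are read from the step model as well. -/
theorem inBase {EB : Functional C C.BgB} {W : Set (ℕ → ℝ)}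
    (hBase : ∀ (g : ℕ → ℝ) (U : C.BgB) (X : C.Dom), M.Base g U X = N.Base (C.scale X) g U) (hN : N.InBase EB W) :
    M.InBase EB W := by
  intro g hg U X
  rw [hBase, h.pointB_eq]
  exact hN (C.scale X) g hg U

/-- [folklore] **THE LIAISON FEEDS THE ACTIVITY ROUTE**: `T4OperatorRateLiaison.operatorRate_of_absRate_floor` (absolute
two-spacing operator rate + a margin floor ⟹ `StepModel.OperatorRate`) composed with the transfer. -/
theorem operatorRate_of_absRate_floor_step {W : Set (ℕ → ℝ)} {δ₀ θ r₀ : ℝ} (hN : AbsOperatorRate N W δ₀ θ)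
    (hfl : ∀ k, r₀ ≤ N.rOp k) (hr₀ : 0 < r₀) (hδ₀ : 0 ≤ δ₀) (hθ : 0 ≤ θ) : M.OperatorRate W (δ₀ / r₀) θ :=
  h.operatorRate (operatorRate_of_absRate_floor N hN hfl hr₀ hδ₀ hθ)

end ReadsStep

/-! ## §2 The term model reading a step model: the route's closure in P1's wall currency -/

namespace TermFamily

open MeasureTheory

variable {ι κ S Ω Ω₀ 𝒴 𝒞 : Type*} [Fintype ι] [Fintype κ] [MeasurableSpace Ω] [MeasurableSpace Ω₀] {J : Type*}
  [DecidableEq ι] [DecidableEq κ] [DecidableEq 𝒞] (𝔉 : TermFamily R Op Hist ι κ S Ω Ω₀ 𝒴 𝒞 J)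

omit [DecidableEq 𝒞] in
/-- [folklore] A term family whose input fields are read from the step model `N` yields a reading term model (the model's
input fields ARE the family's, by construction of `TermFamily.model`). -/
theorem readsStep_model {N : StepModel C Op Hist}
    (hopA : ∀ (g : ℕ → ℝ) (U : C.BgB) (X : C.Dom), 𝔉.opA g U X = N.opA g U (C.scale X))
    (hopB : ∀ (g : ℕ → ℝ) (U : C.BgB) (X : C.Dom), 𝔉.opB g U X = N.opB g U (C.scale X))
    (hinsA : ∀ (g : ℕ → ℝ) (U : C.BgB) (X : C.Dom) (t : C.Dom → ℝ), 𝔉.insA g U X t = N.insA g U (C.scale X) t)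
    (hinsB : ∀ (g : ℕ → ℝ) (U : C.BgB) (X : C.Dom) (t : C.Dom → ℝ), 𝔉.insB g U X t = N.insB g U (C.scale X) t)
    (hϱOp : ∀ X : C.Dom, 𝔉.ϱOp X = N.rOp (C.scale X)) (hϱHist : ∀ X : C.Dom, 𝔉.ϱHist X = N.rHist (C.scale X)) :
    ReadsStep 𝔉.model N :=
  ⟨hopA, hopB, hinsA, hinsB, hϱOp, hϱHist⟩

/-- [folklore] **THE ACTIVITY ROUTE'S CLOSURE IN THE STEP MODEL'S WALL CURRENCY (at the rate `max(θ, r)`, off resonance).**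
`ActivityTermModel.TermFamily.ne5_at_max_of_model_reach` for a term model READING the step model `N`, with the six input
walls supplied as `N`'s: NOT PRINTED `N.OperatorRate` (W1 = NE2 ∧ NE3), `N.InsertionRate` (W4), `N.InsScaleBound` (W3);
printed STRUCTURE `N.InsAffine` ∕ `N.InsBlind` ∕ `N.InsHomog`.  Every other input BY NAME and unchanged (header). -/
theorem ne5_at_max_of_model_reach_step {N : StepModel C Op Hist} (hN : ReadsStep 𝔉.model N) {EA : Functional C C.BgA}
    {EB : Functional C C.BgB} {W : Set (ℕ → ℝ)} {m : (ℕ → ℝ) → C.BgB → R.P → ℝ} {a d : R.P → ℝ} {δX : C.Dom → ℝ}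
    {A A₀ E₀ E₁ κ θ δ δ' c ω s Λop Λhist ρ₀ ρ₀' : ℝ}
    (hwf : 𝔉.WellFormed W)
    (hsum : ∀ g ∈ W, ∀ (U : C.BgB) (X : C.Dom), ∀ γ ∈ R.vol X, ∑ i ∈ 𝔉.terms g U X γ, 𝔉.G Λop Λhist ρ₀ g U X γ i ≤ m g U γ)
    (hρ₁ : ρ₀ ≤ 1)
    (hrep : R.Represents EA EB) (hreal : 𝔉.model.Realizes EA EB W) (hbase : 𝔉.model.InBase EB W)
    (hKP : KPInflated R W m s a d) (hdec : R.DecayExtract δX d) (hpin : R.PinBudget a δX A κ)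
    (hdA : DecayBound EA W A₀ κ) (hdB : DecayBound EB W E₀ κ)
    (hop : N.OperatorRate W δ θ) (hins : N.InsertionRate W κ E₀ δ' θ)
    (haff : N.InsAffine W) (hblind : N.InsBlind W) (hhom : N.InsHomog W)
    (hunit : N.InsScaleBound W κ E₁ c ω)
    (hE₁ : 0 < E₁) (hA : 0 ≤ A) (hΛop : 0 < Λop) (hΛhist : 0 < Λhist) (hρ : max (Λhist / Λop) 1 * ρ₀' ≤ ρ₀)
    (hs : Λhist * ρ₀' < s) (hδ : 0 ≤ δ) (hδ' : 0 ≤ δ') (hθ : 0 ≤ θ) (hθ1 : θ < 1)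
    (hc : 0 ≤ c) (hω : 0 < ω) (hω1 : ω < 1) (hreach : c * (A₀ + E₀) / (1 - ω) < ρ₀')
    (hres : θ ≠ ω + A * Λhist / (s - Λhist * ρ₀') * c) :
    ∃ C₅, NE5 EA EB W κ (max θ (ω + A * Λhist / (s - Λhist * ρ₀') * c)) C₅ :=
  𝔉.ne5_at_max_of_model_reach hwf hsum hρ₁ hrep hreal hbase hKP hdec hpin hdA hdB (hN.operatorRate hop)
    (hN.insertionRate hins) (hN.insAffine haff) (hN.insBlind hblind) (hN.insHomog hhom) (hN.insScaleBound hunit) hE₁ hA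
    hΛop hΛhist hρ hs hδ hδ' hθ hθ1 hc hω hω1 hreach hres

/-- [folklore] **… and at every rate strictly above `max(θ, r)`, resonance included.** -/
theorem ne5_above_max_of_model_reach_step {N : StepModel C Op Hist} (hN : ReadsStep 𝔉.model N) {EA : Functional C C.BgA}
    {EB : Functional C C.BgB} {W : Set (ℕ → ℝ)} {m : (ℕ → ℝ) → C.BgB → R.P → ℝ} {a d : R.P → ℝ} {δX : C.Dom → ℝ}
    {A A₀ E₀ E₁ κ θ δ δ' c ω s Λop Λhist ρ₀ ρ₀' : ℝ}
    (hwf : 𝔉.WellFormed W)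
    (hsum : ∀ g ∈ W, ∀ (U : C.BgB) (X : C.Dom), ∀ γ ∈ R.vol X, ∑ i ∈ 𝔉.terms g U X γ, 𝔉.G Λop Λhist ρ₀ g U X γ i ≤ m g U γ)
    (hρ₁ : ρ₀ ≤ 1)
    (hrep : R.Represents EA EB) (hreal : 𝔉.model.Realizes EA EB W) (hbase : 𝔉.model.InBase EB W)
    (hKP : KPInflated R W m s a d) (hdec : R.DecayExtract δX d) (hpin : R.PinBudget a δX A κ)
    (hdA : DecayBound EA W A₀ κ) (hdB : DecayBound EB W E₀ κ)
    (hop : N.OperatorRate W δ θ) (hins : N.InsertionRate W κ E₀ δ' θ)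
    (haff : N.InsAffine W) (hblind : N.InsBlind W) (hhom : N.InsHomog W)
    (hunit : N.InsScaleBound W κ E₁ c ω)
    (hE₁ : 0 < E₁) (hA : 0 ≤ A) (hΛop : 0 < Λop) (hΛhist : 0 < Λhist) (hρ : max (Λhist / Λop) 1 * ρ₀' ≤ ρ₀)
    (hs : Λhist * ρ₀' < s) (hδ : 0 ≤ δ) (hδ' : 0 ≤ δ') (hθ : 0 ≤ θ) (hθ1 : θ < 1)
    (hc : 0 ≤ c) (hω : 0 < ω) (hω1 : ω < 1) (hreach : c * (A₀ + E₀) / (1 - ω) < ρ₀')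
    {θ' : ℝ} (hθ' : max θ (ω + A * Λhist / (s - Λhist * ρ₀') * c) < θ') :
    ∃ C₅, NE5 EA EB W κ θ' C₅ :=
  𝔉.ne5_above_max_of_model_reach hwf hsum hρ₁ hrep hreal hbase hKP hdec hpin hdA hdB (hN.operatorRate hop)
    (hN.insertionRate hins) (hN.insAffine haff) (hN.insBlind hblind) (hN.insHomog hhom) (hN.insScaleBound hunit) hE₁ hA
    hΛop hΛhist hρ hs hδ hδ' hθ hθ1 hc hω hω1 hreach hθ'

end TermFamily

end Summit.QuantumFields.BalabanUV.T4Continuum.ActivityStepJunction
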